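import Mathlib.RingTheory.MvPolynomial.Basic
import Mathlib.Algebra.MvPolynomial.Monad
import Mathlib.Analysis.Calculus.ContDiff.Defs
import Mathlib.FieldTheory.IsRealClosed.Basic
import Mathlib.MeasureTheory.Constructions.BorelSpace.Basic
import Mathlib.Analysis.SpecialFunctions.Sqrt
import Literature.ModelTheory.ExponentialFields.Semialgebraic
import HarnessLib

-- provenance: harness21/H21/H21/Prelude/TranscendKaehlerL/SemialgebraicMaps.lean @ 8bdf877 (interim HEAD d8f2665); M5 mechanical rewrite
/-!
# Semialgebraic maps and functions (trunk T-TRANSCEND / G26, outline C1)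

A map `f : s → R ^ n` defined on a subset `s ⊆ R ^ m` is *`k`-semialgebraic* if its graph
`{(x, f x) | x ∈ s} ⊆ R ^ (m + n)` is a `k`-semialgebraic set (Bochnak–Coste–Roy, Def. 2.2.5).
We build this on top of `Literature.ModelTheory.ExponentialFields.IsSemialgebraic` (file `Literature.Prelude.TranscendEllArithS.Semialgebraic`),
in the same generality `(k) [CommRing k] {R} [CommRing R] [LT R] [Algebra k R]`, realising
`R ^ m = Fin m → R` and graphs via `Fin.append` (maps) and `Fin.snoc` (scalar functions).

## Main definitions

* `Literature.IsSemialgebraicMapOn k s f` — the graph of `f : (Fin m → R) → (Fin n → R)` over `s` is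
  `k`-semialgebraic.
* `Literature.IsSemialgebraicFunOn k s f` — the graph of `f : (Fin m → R) → R` over `s` is
  `k`-semialgebraic.

## Main statements

* `Literature.ModelTheory.ExponentialFields.IsSemialgebraic.preimage_aeval` — preimages of semialgebraic sets under polynomial maps are
  semialgebraic (proved; no Tarski–Seidenberg needed).
* `Literature.NumberTheory.Transcendental.isSemialgebraicFunOn_aeval`, `Literature.NumberTheory.Transcendental.isSemialgebraicFunOn_aeval_div_aeval` — polynomials and
  quotients of polynomials with non-vanishing denominator are semialgebraic functions (proved).
* `Literature.IsSemialgebraicFunOn.add/sub/mul`, `Literature.NumberTheory.Transcendental.IsSemialgebraicMapOn.comp`,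
  `Literature.NumberTheory.Transcendental.IsSemialgebraicMapOn.isSemialgebraic_image`, `Literature.NumberTheory.Transcendental.isSemialgebraicMapOn_iff_forall` — the
  Tarski–Seidenberg consequences (BCR Prop. 2.2.6, 2.2.7), stated over `ℝ` (proofs deferred); the
  image theorem is also stated over a real closed field.
* `Literature.NumberTheory.Transcendental.IsSemialgebraicFunOn.measurable`, `Literature.NumberTheory.Transcendental.IsSemialgebraicFunOn.exists_contDiffOn` — real
  semialgebraic functions are Borel and smooth off a closed semialgebraic set with empty interior
  (BCR §2.9; proofs deferred).
* `Literature.NumberTheory.Transcendental.IsSemialgebraicFunOn.isSemialgebraic` — over `ℝ`, the domain of a semialgebraic function is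
  semialgebraic.

## References

* J. Bochnak, M. Coste, M.-F. Roy, *Real Algebraic Geometry* (1998), §2.2 (Def. 2.2.5,
  Prop. 2.2.6, Prop. 2.2.7), §2.9.
* M. Kontsevich, D. Zagier, *Periods* (2001), §1.1.

## Design notes

* Mathlib (searched: `emialgebraic`, `IsRealClosed`, `graph`) has no semialgebraic sets or maps.
* Coefficients: Kontsevich–Zagier allow real algebraic parameters, but every `ℚ̄ ∩ ℝ`-semialgebraic
  set is `ℚ`-semialgebraic (an algebraic number is pinned down over `ℚ` by its minimal polynomial
  and rational isolating inequalities; KZ 2001, §1.1), so `k = ℚ` loses nothing.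
* The definition quantifies `∃ x ∈ s`, so `IsSemialgebraicFunOn k s f` only depends on `f` on `s`
  (`IsSemialgebraicFunOn.congr`) and, over `ℝ`, forces `s` itself to be `k`-semialgebraic
  (`IsSemialgebraicFunOn.isSemialgebraic`); this is intended.
* Closure under `-`, `|·|`, `√·` and polynomial operations only needs preimages under polynomial
  maps and is stated over a general ordered ring; closure under `+`, `*`, composition, and the
  image theorem need Tarski–Seidenberg and are stated over `ℝ` (the case used downstream), since
  Mathlib has no `IsRealClosed ℝ` instance at the pinned commit.
-/

noncomputable section

open Set MvPolynomial

namespace Literature.NumberTheory.Transcendental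

section Defs

variable (k : Type*) {R : Type*} [CommRing k] [CommRing R] [LT R] [Algebra k R] {m n : ℕ}

/-- A map `f : R ^ m → R ^ n` is `k`-semialgebraic on `s ⊆ R ^ m` if its graph over `s`,
`{(x, f x) | x ∈ s} ⊆ R ^ (m + n)` (realised via `Fin.append`), is a `k`-semialgebraic set.
[Bochnak–Coste–Roy 1998, Def. 2.2.5] [cite: BochnakCosteRoy1998, Def. 2.2.5] -/
def IsSemialgebraicMapOn (s : Set (Fin m → R)) (f : (Fin m → R) → (Fin n → R)) : Prop :=
  Literature.ModelTheory.ExponentialFields.IsSemialgebraic k {z : Fin (m + n) → R | ∃ x ∈ s, z = Fin.append x (f x)}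

/-- A function `f : R ^ m → R` is `k`-semialgebraic on `s ⊆ R ^ m` if its graph over `s`,
`{(x, f x) | x ∈ s} ⊆ R ^ (m + 1)` (realised via `Fin.snoc`), is a `k`-semialgebraic set.
[Bochnak–Coste–Roy 1998, Def. 2.2.5] [cite: BochnakCosteRoy1998, Def. 2.2.5] -/
def IsSemialgebraicFunOn (s : Set (Fin m → R)) (f : (Fin m → R) → R) : Prop :=
  Literature.ModelTheory.ExponentialFields.IsSemialgebraic k {z : Fin (m + 1) → R | ∃ x ∈ s, z = Fin.snoc x (f x)}

variable {k}

omit [CommRing R] [LT R] in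
/-- The graph of a scalar function over `s`, described by its projections.
[BCR 1998, Def. 2.2.5] [cite: BCR1998, Def. 2.2.5] -/
theorem setOf_exists_eq_snoc (s : Set (Fin m → R)) (f : (Fin m → R) → R) :
    {z : Fin (m + 1) → R | ∃ x ∈ s, z = Fin.snoc x (f x)} =
      {z : Fin (m + 1) → R | Fin.init z ∈ s ∧ z (Fin.last m) = f (Fin.init z)} := by
  ext z
  simp only [mem_setOf_eq]
  constructor
  · rintro ⟨x, hx, rfl⟩
    simpa [Fin.init_snoc, Fin.snoc_last] using hx
  · rintro ⟨h1, h2⟩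
    exact ⟨Fin.init z, h1, by rw [← h2, Fin.snoc_init_self]⟩

omit [CommRing R] [LT R] in
/-- The graph of a map over `s`, described by its projections. [BCR 1998, Def. 2.2.5] [cite: BCR1998, Def. 2.2.5] -/
theorem setOf_exists_eq_append (s : Set (Fin m → R)) (f : (Fin m → R) → (Fin n → R)) :
    {z : Fin (m + n) → R | ∃ x ∈ s, z = Fin.append x (f x)} =
      {z | (fun i => z (Fin.castAdd n i)) ∈ s ∧
        (fun j => z (Fin.natAdd m j)) = f (fun i => z (Fin.castAdd n i))} := by
  ext z
  simp only [mem_setOf_eq]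
  constructor
  · rintro ⟨x, hx, rfl⟩
    simp [Fin.append_left, Fin.append_right, hx]
  · rintro ⟨h1, h2⟩
    exact ⟨_, h1, by rw [← h2, Fin.append_castAdd_natAdd]⟩

/-- Unfolding lemma: `f` is semialgebraic on `s` iff `{z | init z ∈ s ∧ z last = f (init z)}` is
semialgebraic. [BCR 1998, Def. 2.2.5] [cite: BCR1998, Def. 2.2.5] -/
theorem isSemialgebraicFunOn_iff {s : Set (Fin m → R)} {f : (Fin m → R) → R} :
    IsSemialgebraicFunOn k s f ↔
      Literature.ModelTheory.ExponentialFields.IsSemialgebraic k {z : Fin (m + 1) → R | Fin.init z ∈ s ∧ z (Fin.last m) = f (Fin.init z)} := by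
  rw [IsSemialgebraicFunOn, setOf_exists_eq_snoc]

/-- Preimages of `k`-semialgebraic sets under polynomial maps with coefficients in `k` are
`k`-semialgebraic (substitution of polynomials into polynomials; no Tarski–Seidenberg needed).
[BCR 1998, §2.1] [cite: BCR1998, §2.1] -/
theorem _root_.Literature.ModelTheory.ExponentialFields.IsSemialgebraic.preimage_aeval {ι κ : Type*} (P : κ → MvPolynomial ι k)
    {s : Set (κ → R)} (hs : Literature.ModelTheory.ExponentialFields.IsSemialgebraic k s) :
    Literature.ModelTheory.ExponentialFields.IsSemialgebraic k ((fun x : ι → R => fun j => aeval x (P j)) ⁻¹' s) := by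
  induction hs using BooleanSubalgebra.closure_bot_sup_induction with
  | mem t ht =>
    rcases ht with ⟨p, rfl⟩ | ⟨p, rfl⟩
    · convert Literature.ModelTheory.ExponentialFields.isSemialgebraic_setOf_eval_eq_zero (R := R) (bind₁ P p) using 1
      ext x
      simp [aeval_bind₁]
    · convert Literature.ModelTheory.ExponentialFields.isSemialgebraic_setOf_eval_pos (R := R) (bind₁ P p) using 1
      ext x
      simp [aeval_bind₁]
  | bot => exact Literature.ModelTheory.ExponentialFields.isSemialgebraic_empty
  | sup t _ u _ iht ihu => exact iht.union ihu
  | compl t _ iht => exact iht.compl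

/-- Preimages of `k`-semialgebraic sets under coordinate maps `x ↦ x ∘ σ` are `k`-semialgebraic.
[BCR 1998, §2.1] [cite: BCR1998, §2.1] -/
theorem _root_.Literature.ModelTheory.ExponentialFields.IsSemialgebraic.preimage_comp {ι κ : Type*} (σ : κ → ι) {s : Set (κ → R)}
    (hs : Literature.ModelTheory.ExponentialFields.IsSemialgebraic k s) : Literature.ModelTheory.ExponentialFields.IsSemialgebraic k ((fun x : ι → R => x ∘ σ) ⁻¹' s) := by
  convert hs.preimage_aeval (fun j => X (σ j)) using 3 with x
  ext j
  simp

/-- If `s ⊆ R ^ m` is semialgebraic then so is the cylinder `{z ∈ R ^ (m + 1) | init z ∈ s}`.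
[BCR 1998, §2.1] [cite: BCR1998, §2.1] -/
theorem _root_.Literature.ModelTheory.ExponentialFields.IsSemialgebraic.setOf_init_mem {s : Set (Fin m → R)} (hs : Literature.ModelTheory.ExponentialFields.IsSemialgebraic k s) :
    Literature.ModelTheory.ExponentialFields.IsSemialgebraic k {z : Fin (m + 1) → R | Fin.init z ∈ s} :=
  hs.preimage_comp Fin.castSucc

namespace IsSemialgebraicFunOn

variable {s t : Set (Fin m → R)} {f g : (Fin m → R) → R}

/-- Semialgebraicity of a function on `s` only depends on its values on `s`.
[BCR 1998, Def. 2.2.5] [cite: BCR1998, Def. 2.2.5] -/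
theorem congr (hf : IsSemialgebraicFunOn k s f) (h : EqOn f g s) : IsSemialgebraicFunOn k s g := by
  have : {z : Fin (m + 1) → R | Fin.init z ∈ s ∧ z (Fin.last m) = g (Fin.init z)} =
      {z : Fin (m + 1) → R | Fin.init z ∈ s ∧ z (Fin.last m) = f (Fin.init z)} := by
    ext z
    simp only [mem_setOf_eq]
    exact and_congr_right fun hz => by rw [h hz]
  rw [isSemialgebraicFunOn_iff, this]
  exact isSemialgebraicFunOn_iff.mp hf

/-- Restriction of a semialgebraic function to a semialgebraic subset is semialgebraic.
[BCR 1998, §2.2] [cite: BCR1998, §2.2] -/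
theorem mono (hf : IsSemialgebraicFunOn k s f) (hts : t ⊆ s) (ht : Literature.ModelTheory.ExponentialFields.IsSemialgebraic k t) :
    IsSemialgebraicFunOn k t f := by
  rw [isSemialgebraicFunOn_iff] at hf ⊢
  convert hf.inter ht.setOf_init_mem using 1
  ext z
  simp only [mem_setOf_eq, mem_inter_iff]
  exact ⟨fun h => ⟨⟨hts h.1, h.2⟩, h.1⟩, fun h => ⟨h.2, h.1.2⟩⟩

/-- The negative of a semialgebraic function is semialgebraic (preimage of the graph under the
polynomial map `(x, y) ↦ (x, -y)`). [BCR 1998, Prop. 2.2.6] [cite: BCR1998, Prop. 2.2.6] -/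
theorem neg (hf : IsSemialgebraicFunOn k s f) : IsSemialgebraicFunOn k s (-f) := by
  rw [isSemialgebraicFunOn_iff] at hf ⊢
  convert hf.preimage_aeval (Fin.snoc (fun i => X (Fin.castSucc i)) (-X (Fin.last m))) using 1
  ext z
  simp only [mem_setOf_eq, mem_preimage, Pi.neg_apply]
  have h1 : (Fin.init fun j : Fin (m + 1) =>
      aeval z (Fin.snoc (α := fun _ => MvPolynomial (Fin (m + 1)) k)
        (fun i => X (Fin.castSucc i)) (-X (Fin.last m)) j)) = Fin.init z := by
    ext i
    simp [Fin.init]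
  rw [h1]
  simp [neg_eq_iff_eq_neg]

end IsSemialgebraicFunOn

/-- Polynomials with coefficients in `k` are `k`-semialgebraic functions on any `k`-semialgebraic
set. [BCR 1998, §2.2] [cite: BCR1998, §2.2] -/
theorem isSemialgebraicFunOn_aeval {s : Set (Fin m → R)} (hs : Literature.ModelTheory.ExponentialFields.IsSemialgebraic k s)
    (p : MvPolynomial (Fin m) k) : IsSemialgebraicFunOn k s (fun x => aeval x p) := by
  rw [isSemialgebraicFunOn_iff]
  convert hs.setOf_init_mem.inter
    (Literature.ModelTheory.ExponentialFields.isSemialgebraic_setOf_eval_eq_zero (R := R) (X (Fin.last m) - rename Fin.castSucc p)) using 1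
  have hinit : ∀ z : Fin (m + 1) → R, (fun i => z (Fin.castSucc i)) = Fin.init z := fun _ => rfl
  ext z
  simp [aeval_rename, sub_eq_zero, Function.comp_def, hinit]

/-- Unfolding lemma for maps: `f` is semialgebraic on `s` iff
`{z | (z ∘ castAdd) ∈ s ∧ z ∘ natAdd = f (z ∘ castAdd)}` is semialgebraic. [BCR 1998, Def. 2.2.5] [cite: BCR1998, Def. 2.2.5] -/
theorem isSemialgebraicMapOn_iff {s : Set (Fin m → R)} {f : (Fin m → R) → (Fin n → R)} :
    IsSemialgebraicMapOn k s f ↔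
      Literature.ModelTheory.ExponentialFields.IsSemialgebraic k {z : Fin (m + n) → R | (fun i => z (Fin.castAdd n i)) ∈ s ∧
        (fun j => z (Fin.natAdd m j)) = f (fun i => z (Fin.castAdd n i))} := by
  rw [IsSemialgebraicMapOn, setOf_exists_eq_append]

namespace IsSemialgebraicMapOn

variable {s t : Set (Fin m → R)} {f g : (Fin m → R) → (Fin n → R)}

/-- Semialgebraicity of a map on `s` only depends on its values on `s`. [BCR 1998, Def. 2.2.5] [cite: BCR1998, Def. 2.2.5] -/
theorem congr (hf : IsSemialgebraicMapOn k s f) (h : EqOn f g s) : IsSemialgebraicMapOn k s g := by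
  have : {z : Fin (m + n) → R | ∃ x ∈ s, z = Fin.append x (g x)} =
      {z : Fin (m + n) → R | ∃ x ∈ s, z = Fin.append x (f x)} := by
    ext z
    simp only [mem_setOf_eq]
    exact exists_congr fun x => and_congr_right fun hx => by rw [h hx]
  unfold IsSemialgebraicMapOn
  rw [this]
  exact hf

/-- Restriction of a semialgebraic map to a semialgebraic subset is semialgebraic.
[BCR 1998, §2.2] [cite: BCR1998, §2.2] -/
theorem mono (hf : IsSemialgebraicMapOn k s f) (hts : t ⊆ s) (ht : Literature.ModelTheory.ExponentialFields.IsSemialgebraic k t) :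
    IsSemialgebraicMapOn k t f := by
  rw [isSemialgebraicMapOn_iff] at hf ⊢
  convert hf.inter (ht.preimage_comp (Fin.castAdd n)) using 1
  ext z
  simp only [mem_setOf_eq, mem_inter_iff, mem_preimage, Function.comp_def]
  exact ⟨fun h => ⟨⟨hts h.1, h.2⟩, h.1⟩, fun h => ⟨h.2, h.1.2⟩⟩

/-- A map all of whose coordinates are semialgebraic functions on a semialgebraic set `s` is a
semialgebraic map (the graph is a finite intersection of cylinders over the coordinate graphs; this
direction needs no Tarski–Seidenberg). The hypothesis `hs` is needed for `n = 0`.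
[BCR 1998, §2.2] [cite: BCR1998, §2.2] -/
theorem of_forall (hs : Literature.ModelTheory.ExponentialFields.IsSemialgebraic k s) (hf : ∀ j, IsSemialgebraicFunOn k s (fun x => f x j)) :
    IsSemialgebraicMapOn k s f := by
  rw [isSemialgebraicMapOn_iff]
  let σ : Fin n → Fin (m + 1) → Fin (m + n) :=
    fun j => Fin.lastCases (Fin.natAdd m j) (fun i => Fin.castAdd n i)
  have hT : ∀ j, Literature.ModelTheory.ExponentialFields.IsSemialgebraic k ((fun z : Fin (m + n) → R => z ∘ σ j) ⁻¹'
      {w : Fin (m + 1) → R | Fin.init w ∈ s ∧ w (Fin.last m) = f (Fin.init w) j}) :=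
    fun j => (isSemialgebraicFunOn_iff.mp (hf j)).preimage_comp (σ j)
  convert (hs.preimage_comp (Fin.castAdd n)).inter
    (Literature.ModelTheory.ExponentialFields.IsSemialgebraic.biInter Finset.univ _ fun j _ => hT j) using 1
  have hinit : ∀ (z : Fin (m + n) → R) (j : Fin n),
      (Fin.init fun x => z (σ j x)) = fun i => z (Fin.castAdd n i) := by
    intro z j
    ext i
    simp [Fin.init, σ]
  have hlast : ∀ (z : Fin (m + n) → R) (j : Fin n), z (σ j (Fin.last m)) = z (Fin.natAdd m j) := by
    intro z j
    simp [σ]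
  ext z
  simp only [mem_setOf_eq, mem_inter_iff, mem_preimage, Finset.mem_univ,
    mem_iInter, Function.comp_def, hinit, hlast, funext_iff, true_imp_iff]
  exact ⟨fun h => ⟨h.1, fun j => ⟨h.1, h.2 j⟩⟩, fun h => ⟨h.1, fun j => (h.2 j).2⟩⟩

end IsSemialgebraicMapOn

/-- Polynomial maps with coefficients in `k` are `k`-semialgebraic on any `k`-semialgebraic set.
[BCR 1998, §2.2] [cite: BCR1998, §2.2] -/
theorem isSemialgebraicMapOn_aeval {s : Set (Fin m → R)} (hs : Literature.ModelTheory.ExponentialFields.IsSemialgebraic k s)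
    (P : Fin n → MvPolynomial (Fin m) k) :
    IsSemialgebraicMapOn k s (fun x j => aeval x (P j)) :=
  IsSemialgebraicMapOn.of_forall hs fun j => isSemialgebraicFunOn_aeval hs (P j)

/-- The identity map is `k`-semialgebraic on any `k`-semialgebraic set. [BCR 1998, §2.2] [cite: BCR1998, §2.2] -/
theorem isSemialgebraicMapOn_id {s : Set (Fin m → R)} (hs : Literature.ModelTheory.ExponentialFields.IsSemialgebraic k s) :
    IsSemialgebraicMapOn k s id := by
  convert isSemialgebraicMapOn_aeval hs (fun j => X j) using 2 with x
  ext j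
  simp

end Defs

section Field

variable {k : Type*} {R : Type*} [CommRing k] [Field R] [LT R] [Algebra k R] {m : ℕ}

/-- Quotients `p / q` of polynomials with coefficients in `k` are `k`-semialgebraic functions on any
`k`-semialgebraic set on which the denominator does not vanish: the graph is
`{z | init z ∈ s ∧ z last * q (init z) = p (init z)}`.
[BCR 1998, §2.2; Kontsevich–Zagier 2001, §1.1] [cite: BCR1998, §2.2] -/
theorem isSemialgebraicFunOn_aeval_div_aeval {s : Set (Fin m → R)} (hs : Literature.ModelTheory.ExponentialFields.IsSemialgebraic k s)
    (p q : MvPolynomial (Fin m) k) (hq : ∀ x ∈ s, aeval x q ≠ 0) :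
    IsSemialgebraicFunOn k s (fun x => aeval x p / aeval x q) := by
  rw [isSemialgebraicFunOn_iff]
  convert hs.setOf_init_mem.inter (Literature.ModelTheory.ExponentialFields.isSemialgebraic_setOf_eval_eq_zero (R := R)
    (X (Fin.last m) * rename Fin.castSucc q - rename Fin.castSucc p)) using 1
  have hinit : ∀ z : Fin (m + 1) → R, (fun i => z (Fin.castSucc i)) = Fin.init z := fun _ => rfl
  ext z
  simp only [mem_setOf_eq, mem_inter_iff, map_sub, map_mul, aeval_X, aeval_rename,
    Function.comp_def, hinit, sub_eq_zero]
  exact and_congr_right fun hz => by rw [eq_div_iff (hq _ hz)]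

end Field

section LinearOrder

variable {k : Type*} {R : Type*} [CommRing k] [CommRing R] [LinearOrder R] [IsStrictOrderedRing R]
  [Algebra k R] {m : ℕ}

/-- The absolute value of a semialgebraic function is semialgebraic: its graph is
`{0 ≤ y} ∩ (graph f ∪ graph (-f))`. [BCR 1998, Prop. 2.2.6] [cite: BCR1998, Prop. 2.2.6] -/
theorem IsSemialgebraicFunOn.abs {s : Set (Fin m → R)} {f : (Fin m → R) → R}
    (hf : IsSemialgebraicFunOn k s f) : IsSemialgebraicFunOn k s (fun x => |f x|) := by
  have h0 : Literature.ModelTheory.ExponentialFields.IsSemialgebraic k {z : Fin (m + 1) → R | 0 ≤ z (Fin.last m)} := by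
    simpa using Literature.ModelTheory.ExponentialFields.isSemialgebraic_setOf_eval_nonneg (k := k) (R := R) (X (Fin.last m))
  have h1 := isSemialgebraicFunOn_iff.mp hf
  have h2 := isSemialgebraicFunOn_iff.mp hf.neg
  rw [isSemialgebraicFunOn_iff]
  convert h0.inter (h1.union h2) using 1
  ext z
  simp only [mem_setOf_eq, mem_inter_iff, mem_union, Pi.neg_apply]
  constructor
  · rintro ⟨hz, h⟩
    refine ⟨h ▸ abs_nonneg _, ?_⟩
    rcases abs_choice (f (Fin.init z)) with h' | h'
    · exact Or.inl ⟨hz, h.trans h'⟩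
    · exact Or.inr ⟨hz, h.trans h'⟩
  · rintro ⟨hz0, ⟨hz, h⟩ | ⟨hz, h⟩⟩
    · exact ⟨hz, by rw [h, abs_of_nonneg (h ▸ hz0)]⟩
    · exact ⟨hz, by rw [h]; exact (abs_of_nonpos (neg_nonneg.mp (h ▸ hz0))).symm⟩

end LinearOrder

section RealClosed

variable {k : Type*} {R : Type*} [CommRing k] [Field R] [LinearOrder R] [IsStrictOrderedRing R]
  [IsRealClosed R] [Algebra k R] {m n : ℕ}

/-- **Images of semialgebraic maps** over a real closed field: if `f` is `k`-semialgebraic on `s`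
and `t ⊆ s` is `k`-semialgebraic, then `f '' t` is `k`-semialgebraic (Tarski–Seidenberg).
[Bochnak–Coste–Roy 1998, Prop. 2.2.7]

**Defect flag (2026-08-15, mis-stated as elaborated).** The header of this `def` is just `: Prop`,
so the section instances `[IsStrictOrderedRing R] [IsRealClosed R]` (unused in the body) are *not*
parameters of the elaborated statement: `@isSemialgebraic_image_of_isRealClosed` quantifies over
every field `R` with a linear order (e.g. it elaborates at `k := ℤ`, `R := ℚ`), and in that
generality it is false — at `R = ℚ` the image of the semialgebraic map `x ↦ x²` is the set of
rational squares, which is not `ℚ`-semialgebraic. It therefore cannot be discharged as stated.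
Consumers must only ever take `(h : isSemialgebraic_image_of_isRealClosed)` under
`[IsStrictOrderedRing R] [IsRealClosed R]`, where it is the intended (true) BCR Prop. 2.2.7; the
corrected fact, with the two instances quantified *inside* the `Prop`, is
`IsSemialgebraicMapOn.isSemialgebraic_image_rcf` (file
`Literature/NumberTheory/Transcendental/SemialgebraicMapsProofs.lean`, where it is proved). The
same defect affects `Literature.ModelTheory.ExponentialFields.tarski_seidenberg`
(`Semialgebraic.lean`). [cite: BochnakCosteRoy1998, Prop. 2.2.7] -/
def IsSemialgebraicMapOn.isSemialgebraic_image_of_isRealClosed : Prop :=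
  ∀ {s t : Set (Fin m → R)} {f : (Fin m → R) → (Fin n → R)} (hf : IsSemialgebraicMapOn k s f) (hts : t ⊆ s) (ht : Literature.ModelTheory.ExponentialFields.IsSemialgebraic k t),
    Literature.ModelTheory.ExponentialFields.IsSemialgebraic k (f '' t)

end RealClosed

section Real

open scoped ContDiff

variable {k : Type*} [CommRing k] [Algebra k ℝ] {m n l : ℕ}

namespace IsSemialgebraicFunOn

variable {s : Set (Fin m → ℝ)} {f g : (Fin m → ℝ) → ℝ}

/-- Over `ℝ`, the domain of a semialgebraic function is semialgebraic: it is the projection of the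
graph (Tarski–Seidenberg). In particular `IsSemialgebraicFunOn ℚ U F` forces `U` itself to be
`ℚ`-semialgebraic; this is intended. [BCR 1998, Thm. 2.2.1, §2.2] [cite: BCR1998, Thm. 2.2.1  §2.2] -/
def isSemialgebraic : Prop :=
  ∀ (hf : IsSemialgebraicFunOn k s f),
    Literature.ModelTheory.ExponentialFields.IsSemialgebraic k s

/- interim proof relied on results that are now named facts (D-0014); demoted to a fact by the M5 import, proof preserved:
:= by
  convert tarski_seidenberg_real hf using 1
  ext x
  simp only [mem_image, mem_setOf_eq]
  constructor
  · intro hx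
    exact ⟨Fin.snoc x (f x), ⟨x, hx, rfl⟩, funext fun i => by simp⟩
  · rintro ⟨z, ⟨y, hy, rfl⟩, rfl⟩
    convert hy
    exact funext fun i => by simp
-/

/-- The sum of two real semialgebraic functions is semialgebraic (Tarski–Seidenberg).
[BCR 1998, Prop. 2.2.6] [cite: BCR1998, Prop. 2.2.6] -/
def add : Prop :=
  ∀ (hf : IsSemialgebraicFunOn k s f) (hg : IsSemialgebraicFunOn k s g),
    IsSemialgebraicFunOn k s (f + g)

/-- The difference of two real semialgebraic functions is semialgebraic.
[BCR 1998, Prop. 2.2.6] [cite: BCR1998, Prop. 2.2.6] -/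
def sub : Prop :=
  ∀ (hf : IsSemialgebraicFunOn k s f) (hg : IsSemialgebraicFunOn k s g),
    IsSemialgebraicFunOn k s (f - g)

/- interim proof relied on results that are now named facts (D-0014); demoted to a fact by the M5 import, proof preserved:
:= by
  simpa [sub_eq_add_neg] using hf.add hg.neg
-/

/-- The product of two real semialgebraic functions is semialgebraic (Tarski–Seidenberg).
[BCR 1998, Prop. 2.2.6] [cite: BCR1998, Prop. 2.2.6] -/
def mul : Prop :=
  ∀ (hf : IsSemialgebraicFunOn k s f) (hg : IsSemialgebraicFunOn k s g),
    IsSemialgebraicFunOn k s (f * g)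

/-- The square root of a real semialgebraic function is semialgebraic (with Mathlib's junk value
`√y = 0` for `y < 0`, which is itself semialgebraic). [BCR 1998, §2.2] [cite: BCR1998, §2.2] -/
def sqrt : Prop :=
  ∀ (hf : IsSemialgebraicFunOn k s f),
    IsSemialgebraicFunOn k s (fun x => √(f x))

/-- Real semialgebraic functions are Borel measurable on their domain.
[BCR 1998, §2.2; Kontsevich–Zagier 2001, §1.1] [cite: BCR1998, §2.2] -/
def measurable : Prop :=
  ∀ (hf : IsSemialgebraicFunOn k s f),
    Measurable (s.restrict f)

/-- **Piecewise smoothness** of semialgebraic functions: a real semialgebraic function on an open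
set `s` is `C^∞` (indeed Nash) off a relatively closed `k`-semialgebraic subset `Z ⊆ s` with empty
interior (`dim Z < m`). [Bochnak–Coste–Roy 1998, §2.9 (Prop. 2.9.10 with the stratification
Thm. 9.1.8)] [cite: BochnakCosteRoy1998, §2.9 (Prop. 2.9.10 with the stratificati] -/
def exists_contDiffOn : Prop :=
  ∀ (hs : IsOpen s) (hf : IsSemialgebraicFunOn k s f),
    ∃ Z : Set (Fin m → ℝ), Z ⊆ s ∧ Literature.ModelTheory.ExponentialFields.IsSemialgebraic k Z ∧ interior Z = ∅ ∧ IsOpen (s \ Z) ∧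
      ContDiffOn ℝ ∞ f (s \ Z)

end IsSemialgebraicFunOn

/-- The square root `x ↦ √x` is a `k`-semialgebraic function on `{x | 0 ≤ x} ⊆ ℝ ^ 1`: its graph is
`{(x, y) | 0 ≤ x ∧ 0 ≤ y ∧ y ^ 2 = x}`. [BCR 1998, §2.2] [cite: BCR1998, §2.2] -/
def isSemialgebraicFunOn_sqrt : Prop :=
  IsSemialgebraicFunOn k {x : Fin 1 → ℝ | 0 ≤ x 0} (fun x => √(x 0))

/-- Over `ℝ`, a map on a semialgebraic set is semialgebraic iff all its coordinate functions are
(the forward direction projects the graph; Tarski–Seidenberg). [BCR 1998, §2.2] [cite: BCR1998, §2.2] -/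
def isSemialgebraicMapOn_iff_forall : Prop :=
  ∀ {s : Set (Fin m → ℝ)} {f : (Fin m → ℝ) → (Fin n → ℝ)} (hs : Literature.ModelTheory.ExponentialFields.IsSemialgebraic k s),
    IsSemialgebraicMapOn k s f ↔ ∀ j, IsSemialgebraicFunOn k s (fun x => f x j)

/- interim partial proof (harness21 @ d8f2665), preserved for route work:
:= by
  refine ⟨fun hf j => ?_, IsSemialgebraicMapOn.of_forall hs⟩
  sorry
-/

namespace IsSemialgebraicMapOn

variable {s : Set (Fin m → ℝ)} {t : Set (Fin n → ℝ)} {f : (Fin m → ℝ) → (Fin n → ℝ)}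

/-- Over `ℝ`, the domain of a semialgebraic map is semialgebraic (iterated projection of the
graph; Tarski–Seidenberg). [BCR 1998, Thm. 2.2.1, §2.2] [cite: BCR1998, Thm. 2.2.1  §2.2] -/
def isSemialgebraic : Prop :=
  ∀ (hf : IsSemialgebraicMapOn k s f),
    Literature.ModelTheory.ExponentialFields.IsSemialgebraic k s

/-- **Images of semialgebraic maps** over `ℝ`: if `f` is `k`-semialgebraic on `s` and `t ⊆ s` is
`k`-semialgebraic, then `f '' t` is `k`-semialgebraic (Tarski–Seidenberg).
[Bochnak–Coste–Roy 1998, Prop. 2.2.7] [cite: BochnakCosteRoy1998, Prop. 2.2.7] -/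
def isSemialgebraic_image : Prop :=
  ∀ (hf : IsSemialgebraicMapOn k s f) {t : Set (Fin m → ℝ)} (hts : t ⊆ s) (ht : Literature.ModelTheory.ExponentialFields.IsSemialgebraic k t),
    Literature.ModelTheory.ExponentialFields.IsSemialgebraic k (f '' t)

/-- The composite of real semialgebraic maps is semialgebraic (Tarski–Seidenberg).
[Bochnak–Coste–Roy 1998, Prop. 2.2.6] [cite: BochnakCosteRoy1998, Prop. 2.2.6] -/
def comp : Prop :=
  ∀ {g : (Fin n → ℝ) → (Fin l → ℝ)} (hg : IsSemialgebraicMapOn k t g) (hf : IsSemialgebraicMapOn k s f) (hst : MapsTo f s t),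
    IsSemialgebraicMapOn k s (g ∘ f)

end IsSemialgebraicMapOn

/-- The composite of a real semialgebraic function with a real semialgebraic map is semialgebraic
(Tarski–Seidenberg). [Bochnak–Coste–Roy 1998, Prop. 2.2.6] [cite: BochnakCosteRoy1998, Prop. 2.2.6] -/
def IsSemialgebraicFunOn.comp_isSemialgebraicMapOn : Prop :=
  ∀ {s : Set (Fin m → ℝ)} {t : Set (Fin n → ℝ)} {f : (Fin m → ℝ) → (Fin n → ℝ)} {g : (Fin n → ℝ) → ℝ} (hg : IsSemialgebraicFunOn k t g) (hf : IsSemialgebraicMapOn k s f) (hst : MapsTo f s t),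
    IsSemialgebraicFunOn k s (g ∘ f)

end Real

end Literature.NumberTheory.Transcendental

/-! ### Images of semialgebraic maps from the Tarski–Seidenberg projection theorem

The image theorem over a real closed field (`IsSemialgebraicMapOn.isSemialgebraic_image_of_isRealClosed`,
BCR Prop. 2.2.7; Basu–Pollack–Roy Thm. 2.76 for coefficients in a subring) is reduced here to the
projection form of the Tarski–Seidenberg theorem (`Literature.ModelTheory.ExponentialFields.tarski_seidenberg`,
BCR Thm. 2.2.1): `f '' t` is the projection onto the last `n` coordinates of
`graph f ∩ (t × Rⁿ) ⊆ R^(m+n)`, i.e. (after swapping the two coordinate blocks) the image of a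
semialgebraic subset of `R^(n+m)` under the map forgetting the last `m` coordinates, which is an
`m`-fold iterate of the projection forgetting the last coordinate. -/

namespace Literature.NumberTheory.Transcendental

section RealClosedProofs

/- **Defect note.** Both named facts related here,
`Literature.ModelTheory.ExponentialFields.tarski_seidenberg` (`Semialgebraic.lean`) and
`IsSemialgebraicMapOn.isSemialgebraic_image_of_isRealClosed` (this file), are MIS-STATED as
elaborated: their `[IsStrictOrderedRing R] [IsRealClosed R]` section instances are unused in the
bodies of the `def`s and hence not parameters of the statements, which thus quantify over every
field `R` with a linear order and are false in that generality (`R = ℚ`: the projection of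
`{y² = x}` is the set of rational squares). They must only be consumed under `[IsRealClosed R]`
(with its order), and corrected restatements quantify the instances inside the `Prop`. The
reduction below — BCR's deduction of Prop. 2.2.7 from Thm. 2.2.1 — is itself valid over any
field with a linear order, so no order axiom is assumed in this section, and it applies verbatim
to the corrected statements. -/
variable {k : Type*} {R : Type*} [CommRing k] [Field R] [LinearOrder R] [Algebra k R] {m n : ℕ}

/-- Iterating the Tarski–Seidenberg projection: if projections forgetting the last coordinate
preserve `k`-semialgebraicity, then so does the projection `R^(n+j) → Rⁿ` forgetting the last `j`
coordinates. [BCR 1998, Thm. 2.2.1] [cite: BochnakCosteRoy1998, Thm. 2.2.1] -/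
theorem _root_.Literature.ModelTheory.ExponentialFields.IsSemialgebraic.image_castAdd_of_tarski_seidenberg
    (hTS : Literature.ModelTheory.ExponentialFields.tarski_seidenberg (k := k) (R := R)) :
    ∀ (j : ℕ) {n : ℕ} {s : Set (Fin (n + j) → R)},
      Literature.ModelTheory.ExponentialFields.IsSemialgebraic k s →
        Literature.ModelTheory.ExponentialFields.IsSemialgebraic k
          ((fun (x : Fin (n + j) → R) (i : Fin n) => x (Fin.castAdd j i)) '' s)
  | 0, n, s, hs => by
    have h0 : (fun (x : Fin (n + 0) → R) (i : Fin n) => x (Fin.castAdd 0 i)) = id := by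
      funext x i
      exact congrArg x (Fin.ext rfl)
    rw [h0, Set.image_id]
    exact hs
  | j + 1, n, s, hs => by
    have h1 := hTS hs
    have h2 := Literature.ModelTheory.ExponentialFields.IsSemialgebraic.image_castAdd_of_tarski_seidenberg
      hTS j h1
    rw [Set.image_image] at h2
    convert h2 using 4 with x _ i
    exact congrArg x (Fin.ext rfl)

/-- **Images of semialgebraic maps from Tarski–Seidenberg.** Over a real closed field, the
projection theorem `tarski_seidenberg` (BCR Thm. 2.2.1) implies that the image `f '' t` of a
`k`-semialgebraic `t ⊆ s` under a map `f` that is `k`-semialgebraic on `s` is `k`-semialgebraic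
(BCR Prop. 2.2.7; Basu–Pollack–Roy 2006, Thm. 2.76 for coefficients in a subring): `f '' t` is the
projection forgetting the last `m` coordinates of the block-swapped set `graph f ∩ (t × Rⁿ)`.
[Bochnak–Coste–Roy 1998, Prop. 2.2.7] [cite: BochnakCosteRoy1998, Prop. 2.2.7] -/
theorem IsSemialgebraicMapOn.isSemialgebraic_image_of_isRealClosed_of_tarski_seidenberg
    (hTS : Literature.ModelTheory.ExponentialFields.tarski_seidenberg (k := k) (R := R)) :
    IsSemialgebraicMapOn.isSemialgebraic_image_of_isRealClosed (k := k) (R := R) (m := m) (n := n) := by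
  intro s t f hf hts ht
  rw [isSemialgebraicMapOn_iff] at hf
  -- the graph over `t`, as a subset of `R^(m+n)`
  have hG := hf.inter (ht.preimage_comp (Fin.castAdd n))
  -- swap the two coordinate blocks: `τ (castAdd n i) = natAdd n i`, `τ (natAdd m j) = castAdd m j`
  let τ : Fin (m + n) → Fin (n + m) :=
    Fin.append (fun i : Fin m => Fin.natAdd n i) (fun j : Fin n => Fin.castAdd m j)
  have hτ₁ : ∀ i : Fin m, τ (Fin.castAdd n i) = Fin.natAdd n i := fun i => by
    simp [τ]
  have hτ₂ : ∀ j : Fin n, τ (Fin.natAdd m j) = Fin.castAdd m j := fun j => by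
    simp [τ]
  have hG' := (hG.preimage_comp τ).image_castAdd_of_tarski_seidenberg hTS m
  convert hG' using 1
  ext y
  simp only [mem_image, mem_inter_iff, mem_setOf_eq, mem_preimage, Function.comp_def, hτ₁, hτ₂]
  constructor
  · rintro ⟨x, hx, rfl⟩
    refine ⟨Fin.append (f x) x, ⟨⟨?_, ?_⟩, ?_⟩, ?_⟩
    · simpa using hts hx
    · simp
    · simpa using hx
    · simp
  · rintro ⟨w, ⟨⟨-, hw⟩, hwt⟩, rfl⟩
    exact ⟨fun i => w (Fin.natAdd n i), hwt, hw.symm⟩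

end RealClosedProofs

end Literature.NumberTheory.Transcendental
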